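import Literature.Analysis.FluidPDE.AncientMildWeak
import Literature.Analysis.FluidPDE.ClassicalBoundedWeak
import Literature.Analysis.FluidPDE.KNSSLiouvillePlanarHolds
import Literature.Analysis.FluidPDE.SteadyNSSolution
import Literature.Analysis.FluidPDE.KNSSLemma31Caloric
import HarnessLib

/-!
# Blow-up scenario census, block S: bounded `C²` steady Navier–Stokes solutions are smooth
# (the regularity input of census row S2)

Cell `pub/ns-census` (typer seat `ns-census-typer-1` g5, prover work announced 2026-08-28T15:58Z).  Census row
S2 (`Row_S2 := FP.KorobkovPileckasRusso2015_liouville_noSwirl`, Korobkov–Pileckas–Russo, JMFM 17 (2015) Thm 1.1) is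
typed over `C²` velocities / `C¹` pressures (`IsLerayProfile ν 0 U P`), whereas the tree's reduction of the axisymmetric
no-swirl steady Liouville theorem to KNSS 2009 Thm 5.2 (`Tightness.normalise`, `Tightness.steady_hypotheses`,
`parabolicGaldiLiouville_axisymmetric_noSwirl`; sub-row S2s, `ScenarioCensusSteadyS2s`) needs SMOOTH profiles.  This
file supplies the missing regularity, with the tree's PARABOLIC machinery instead of elliptic estimates:

* `steady_slice_identity` — for a `C²` steady solution `(W, Q)` of the unforced system with viscosity `ν`
  (`IsSteadyNSSolution ν 0 W Q`) and every `C²` compactly supported divergence-free field `φ`,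
  `∫⟪W, (W·∇)φ⟫ + ν ∫⟪W, Δφ⟫ = 0` (integration by parts on the whole space: `integral_inner_convect_add_eq_zero`,
  `integral_inner_laplacian_comm`, and `∫⟪∇Q, φ⟫ = 0` by `integral_mul_divergence_add_eq_zero_right`);
* `isBoundedWeakNSSolutionOn_const` — hence, if `‖W‖ ≤ M`, the time-independent field `fun _ => W` is a bounded
  weak solution on every slab `(−∞, T) × E` in the sense of KNSS 2009 §4 (ii) (`IsBoundedWeakNSSolutionOn`; the
  remaining term `∫∫⟪W, ∂ₜψ⟫` dies by the fundamental theorem of calculus on time lines — plumbing adapted from the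
  tree's `IsClassicalNSSolutionOn.isBoundedWeakNSSolutionOn`);
* `contDiff_velocity_of_bounded` — a `C²` steady solution on `ℝ³` with bounded velocity has a `C^∞` velocity: at
  `ν = 1` (`IsSteadyNSSolution.viscosity_one`) KNSS's §4 regularity of bounded weak ancient solutions
  (`KNSS2009_regularity_boundedWeak_ancient_holds`, PROVED in the tree) provides a representative `U(t) + b(t)` with
  smooth slices, a.e. equal to `W` at a.e. time; continuity upgrades one such identity to `W = U(t₀) + b(t₀)`;
* `contDiff_pressure_of_bounded` — then the pressure is `C^∞` too (`∇Q = νΔW − (W·∇)W` is smooth,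
  `contDiff_infty_iff_fderiv`);
* `contDiff_of_isLerayProfile_zero_of_tendsto` — the form consumed by the census: a Leray profile at rate `0`
  (`IsLerayProfile ν 0 U P`, `ν > 0`) with `U → 0` at infinity is smooth together with its pressure.

No summit statement is proved here; nothing in this file is a claim about NS regularity (the forward problem); the
statements are the classical interior regularity of bounded steady solutions, obtained through KNSS 2009 §4.
-/

-- the summit and its single problem share the name (D-0017 nested layout)
set_option linter.dupNamespace false

noncomputable section

open MeasureTheory Set Function Filter Topology TopologicalSpace InnerProductSpace
open scoped RealInnerProductSpace Laplacian ContDiff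

namespace Summit.NavierStokesRegularity.NavierStokesRegularity.Theorems.ScenarioCensus.SteadyRegularity

open Literature.Analysis Literature.Analysis.FluidPDE

variable {E : Type*} [NormedAddCommGroup E] [InnerProductSpace ℝ E] [FiniteDimensional ℝ E]
  [MeasurableSpace E] [BorelSpace E]

/-! ### The steady slice identity -/

/-- **The steady slice identity.**  For a `C²` steady solution `(W, Q)` of the unforced Navier–Stokes system with
viscosity `ν` and every `C²` compactly supported divergence-free field `φ`:
`∫⟪W, (W·∇)φ⟫ + ν ∫⟪W, Δφ⟫ = 0` — pair `−νΔW + (W·∇)W + ∇Q = 0` with `φ` and integrate by parts on the whole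
space (`div W = 0` moves `(W·∇)` across, Green's second identity moves `Δ`, and `∫⟪∇Q, φ⟫ = −∫ Q div φ = 0`).
[cite: KochNadirashviliSereginSverak2009, §4 (ii) (arXiv:0709.3599 p. 8); Leray1934 §6 (1.11)] -/
theorem steady_slice_identity {ν : ℝ} {W : E → E} {Q : E → ℝ} (h : IsSteadyNSSolution ν 0 W Q)
    {φ : E → E} (hφ : ContDiff ℝ 2 φ) (hc : HasCompactSupport φ) (hdiv : VectorCalculus.IsDivFree φ) :
    (∫ x, ⟪W x, convect W φ x⟫) + ν * ∫ x, ⟪W x, (Δ φ) x⟫ = 0 := by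
  have hW2 : ContDiff ℝ 2 W := h.contDiff_velocity
  have hW1 : ContDiff ℝ 1 W := hW2.of_le one_le_two
  have hQ1 : ContDiff ℝ 1 Q := h.contDiff_pressure
  have hφ1 : ContDiff ℝ 1 φ := hφ.of_le one_le_two
  have hWc : Continuous W := hW1.continuous
  have hφc : Continuous φ := hφ1.continuous
  -- the momentum equation, solved for the convective term
  have hmom : ∀ y, convect W W y = ν • (Δ W) y - gradient Q y := fun y => by
    have e := h.momentum y
    simp only [Pi.zero_apply] at e
    rw [eq_sub_iff_add_eq, ← sub_eq_zero]
    rw [← e]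
    abel
  -- (W·∇) moves across: `∫⟪(W·∇)W, φ⟫ = −∫⟪W, (W·∇)φ⟫`
  have hconv : (∫ x, ⟪convect W W x, φ x⟫) + ∫ x, ⟪W x, convect W φ x⟫ = 0 := by
    have h0 := integral_inner_convect_add_eq_zero hW1 hW1 hφ1 hc
    have hz : ∫ x, VectorCalculus.divergence W x * ⟪W x, φ x⟫ = 0 := by
      simp [h.divFree _]
    linarith
  -- Green's second identity
  have hlap : ∫ x, ⟪(Δ W) x, φ x⟫ = ∫ x, ⟪W x, (Δ φ) x⟫ := integral_inner_laplacian_comm hW2 hφ hc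
  -- the pressure drops out against the divergence-free field
  have hgrad : ∫ x, ⟪gradient Q x, φ x⟫ = 0 := by
    have key := integral_mul_divergence_add_eq_zero_right hQ1 hφ1 hc
    have h0 : (fun x => Q x * VectorCalculus.divergence φ x) = fun _ => (0 : ℝ) :=
      funext fun x => by rw [hdiv x, mul_zero]
    have h2 : (fun x => ⟪φ x, gradient Q x⟫) = fun x => ⟪gradient Q x, φ x⟫ :=
      funext fun x => real_inner_comm _ _
    rw [h0, h2, integral_zero, zero_add] at key
    exact key
  -- integrability of the pieces
  have iL : Integrable (fun x => ⟪(Δ W) x, φ x⟫) (volume : Measure E) :=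
    integrable_inner_of_hasCompactSupport_right (continuous_laplacian hW2) hφc hc
  have iG : Integrable (fun x => ⟪gradient Q x, φ x⟫) (volume : Measure E) :=
    integrable_inner_of_hasCompactSupport_right (continuous_gradient_of_contDiff hQ1) hφc hc
  -- `∫⟪(W·∇)W, φ⟫ = ν ∫⟪ΔW, φ⟫ − ∫⟪∇Q, φ⟫ = ν ∫⟪W, Δφ⟫`
  have hA : ∫ x, ⟪convect W W x, φ x⟫ = ν * ∫ x, ⟪W x, (Δ φ) x⟫ := by
    have hpt : (fun x => ⟪convect W W x, φ x⟫) =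
        fun x => ν * ⟪(Δ W) x, φ x⟫ - ⟪gradient Q x, φ x⟫ := funext fun x => by
      rw [hmom x, inner_sub_left, real_inner_smul_left]
    rw [hpt, integral_sub (iL.const_mul ν) iG, integral_const_mul, hgrad, sub_zero, hlap]
  linarith

/-! ### Time-independent bounded `C²` steady solutions are KNSS bounded weak solutions -/

/-- **A bounded `C²` steady solution is a KNSS bounded weak solution on every ancient slab.**  If `(W, Q)` is a
`C²`/`C¹` steady solution of the unforced system with viscosity `ν` and `‖W‖ ≤ M`, then the time-independent field
`fun _ => W` is a bounded weak solution on `(−∞, T) × E` (`IsBoundedWeakNSSolutionOn`, KNSS 2009 §4 (ii)): the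
spatial terms of the weak formulation vanish slice by slice (`steady_slice_identity`), and `∫∫⟪W, ∂ₜψ⟫ = 0` by the
fundamental theorem of calculus on each time line (the test field vanishes at both ends of a compact time interval
containing its time support). [cite: KochNadirashviliSereginSverak2009, §4 (ii) (arXiv:0709.3599 p. 8)] -/
theorem isBoundedWeakNSSolutionOn_const {ν T : ℝ} {W : E → E} {Q : E → ℝ} (h : IsSteadyNSSolution ν 0 W Q)
    {M : ℝ} (hM : ∀ x, ‖W x‖ ≤ M) :
    IsBoundedWeakNSSolutionOn (Iio T) isOpen_Iio ν (fun _ : ℝ => W) := by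
  have hW2 : ContDiff ℝ 2 W := h.contDiff_velocity
  have hW1 : ContDiff ℝ 1 W := hW2.of_le one_le_two
  have hWc : Continuous W := hW1.continuous
  have hu_cont : ContinuousOn (uncurry fun _ : ℝ => W) (Iio T ×ˢ univ) :=
    (hWc.comp continuous_snd).continuousOn
  refine ⟨?_, ⟨M, fun _ _ x => hM x⟩, ?_, ?_⟩
  · exact hu_cont.aestronglyMeasurable (measurableSet_Iio.prod MeasurableSet.univ)
  · exact (ae_restrict_iff' measurableSet_Iio).2 (Eventually.of_forall fun t _ =>
      VectorCalculus.IsDivFree.isWeaklyDivFree_holds h.divFree hW1)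
  intro ψ hψ hdiv
  -- time support `[a', b'] ⊂ (−∞, T)` and a compact interval `[a₁, b₁]` around it
  obtain ⟨a', b', ha'b', hb'T, hsupp⟩ := hψ.exists_time_support_lt
  set a₁ : ℝ := a' - 1 with ha₁
  set b₁ : ℝ := (b' + T) / 2 with hb₁
  have ha₁a' : a₁ < a' := by rw [ha₁]; linarith
  have hb'b₁ : b' < b₁ := by rw [hb₁]; linarith
  have hb₁T : b₁ < T := by rw [hb₁]; linarith
  have ha₁b₁ : a₁ < b₁ := by linarith
  -- values of `ψ` and its derived fields off the time support
  have hψ0 : ∀ t, t ∉ Icc a' b' → ∀ x, ψ t x = 0 := fun t ht x => by rw [hsupp t ht]; rfl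
  have hψa₁ : ∀ x, ψ a₁ x = 0 := hψ0 a₁ fun ht => (not_le.2 ha₁a') ht.1
  have hψb₁ : ∀ x, ψ b₁ x = 0 := hψ0 b₁ fun ht => (not_le.2 hb'b₁) ht.2
  have hzero : ∀ t, t ∉ Icc a' b' → ∀ x,
      ⟪W x, timeDeriv ψ t x⟫ + ⟪W x, convect W (ψ t) x⟫ + ν * ⟪W x, Δ (ψ t) x⟫ = 0 := by
    intro t ht x
    have hopen : IsOpen (Icc a' b')ᶜ := isClosed_Icc.isOpen_compl
    have hnear : (fun s => ψ s x) =ᶠ[𝓝 t] fun _ => (0 : E) :=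
      Filter.eventually_of_mem (hopen.mem_nhds ht) fun s hs => hψ0 s hs x
    have h1 : timeDeriv ψ t x = 0 := by
      rw [timeDeriv_apply, hnear.deriv_eq, deriv_const]
    have h2 : fderiv ℝ (ψ t) x = 0 := by
      rw [show ψ t = fun _ => (0 : E) from funext (hψ0 t ht), fderiv_fun_const, Pi.zero_apply]
    have h3 : Δ (ψ t) x = 0 :=
      laplacian_eq_zero_of_notMem_tsupport (by
        rw [hsupp t ht, tsupport_eq_empty_iff.2 rfl]; exact notMem_empty x)
    rw [h1, convect_apply, h2, h3]
    simp
  -- reduce the time integral to `(a₁, b₁)`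
  rw [setIntegral_eq_of_subset_of_forall_sdiff_eq_zero (measurableSet_Iio (a := T))
    (fun t ht => lt_trans ht.2 hb₁T : Ioo a₁ b₁ ⊆ Iio T)]
  swap
  · intro t ht
    have ht' : t ∉ Icc a' b' := fun h' => ht.2 ⟨ha₁a'.trans_le h'.1, h'.2.trans_lt hb'b₁⟩
    simp only [hzero t ht', integral_zero]
  -- the compact `x`-shadow of the test field
  obtain ⟨K, hK, hKt⟩ := hψ.exists_compact_slice_subset
  have hψK : ∀ t, ∀ x ∉ K, ψ t x = 0 := fun t x hx =>
    image_eq_zero_of_notMem_tsupport fun h' => hx (hKt t h')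
  -- the space–time integrand `∂ₜ ⟪W, ψ⟫`
  set D : ℝ × E → ℝ := fun z => ⟪W z.2, timeDeriv ψ z.1 z.2⟫ with hD
  have hDcont : ContinuousOn D (Icc a₁ b₁ ×ˢ univ) :=
    ContinuousOn.inner (hWc.comp continuous_snd).continuousOn hψ.continuous_timeDeriv.continuousOn
  have hDK : ∀ t ∈ Icc a₁ b₁, ∀ x ∉ K, D (t, x) = 0 := fun t _ x hx => by
    simp only [hD]
    rw [timeDeriv_eq_zero_of_forall (fun s => hψK s x hx)]
    simp
  have hDint := integrable_prod_of_continuousOn hK hDcont hDK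
  -- slice identity for every `t ∈ (a₁, b₁)`: the spatial terms vanish
  have hslice : ∀ t ∈ Ioo a₁ b₁, ∫ x, (⟪W x, timeDeriv ψ t x⟫ + ⟪W x, convect W (ψ t) x⟫ +
      ν * ⟪W x, Δ (ψ t) x⟫) = ∫ x, D (t, x) := by
    intro t _
    have hψ2 : ContDiff ℝ 2 (ψ t) := contDiff_infty.1 (hψ.contDiff_slice t) 2
    have hψ1 : ContDiff ℝ 1 (ψ t) := hψ2.of_le one_le_two
    have key := steady_slice_identity h hψ2 (hψ.hasCompactSupport_slice t) (hdiv t)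
    have i1 : Integrable (fun x => ⟪W x, timeDeriv ψ t x⟫) (volume : Measure E) :=
      integrable_inner_of_hasCompactSupport_right hWc
        (hψ.continuous_timeDeriv.comp (Continuous.prodMk_right t))
        (HasCompactSupport.intro hK fun x hx => timeDeriv_eq_zero_of_forall
          (fun s => hψK s x hx) t)
    have iC' : Integrable (fun x => ⟪W x, convect W (ψ t) x⟫) (volume : Measure E) :=
      integrable_inner_of_hasCompactSupport_right hWc
        ((hψ1.continuous_fderiv one_ne_zero).clm_apply hWc)
        (((hψ.hasCompactSupport_slice t).fderiv (𝕜 := ℝ)).mono fun x hx => by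
          contrapose! hx; simp only [mem_support, not_not] at hx; simp [convect, hx])
    have iL' : Integrable (fun x => ν * ⟪W x, Δ (ψ t) x⟫) (volume : Measure E) :=
      (integrable_inner_of_hasCompactSupport_right hWc (continuous_laplacian hψ2)
        ((hψ.hasCompactSupport_slice t).mono' fun x hx => by
          contrapose! hx; simp [laplacian_eq_zero_of_notMem_tsupport hx])).const_mul ν
    have i3 : Integrable (fun x => ⟪W x, convect W (ψ t) x⟫ + ν * ⟪W x, Δ (ψ t) x⟫)
        (volume : Measure E) := iC'.add iL'
    have h3 : ∫ x, (⟪W x, convect W (ψ t) x⟫ + ν * ⟪W x, Δ (ψ t) x⟫) = 0 := by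
      rw [integral_add iC' iL', integral_const_mul]
      exact key
    calc ∫ x, (⟪W x, timeDeriv ψ t x⟫ + ⟪W x, convect W (ψ t) x⟫ + ν * ⟪W x, Δ (ψ t) x⟫)
        = ∫ x, (⟪W x, timeDeriv ψ t x⟫ + (⟪W x, convect W (ψ t) x⟫ + ν * ⟪W x, Δ (ψ t) x⟫)) :=
          integral_congr_ae (Eventually.of_forall fun x => by ring)
      _ = (∫ x, ⟪W x, timeDeriv ψ t x⟫) + 0 := by rw [integral_add i1 i3, h3]
      _ = ∫ x, D (t, x) := by rw [add_zero]
  -- integrate the slice identity in time and swap the integrals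
  have hstep : ∫ t in Ioo a₁ b₁, ∫ x, (⟪W x, timeDeriv ψ t x⟫ + ⟪W x, convect W (ψ t) x⟫ +
      ν * ⟪W x, Δ (ψ t) x⟫) = ∫ x, ∫ t in Ioo a₁ b₁, D (t, x) := by
    rw [setIntegral_congr_fun measurableSet_Ioo hslice]
    exact integral_integral_swap (f := fun t x => D (t, x)) hDint
  -- fundamental theorem of calculus on each time line: both boundary terms vanish
  have hline : ∀ x, ∫ t in Ioo a₁ b₁, D (t, x) = 0 := by
    intro x
    have hcont : ContinuousOn (fun t => ⟪W x, ψ t x⟫) (Icc a₁ b₁) :=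
      ContinuousOn.inner continuousOn_const
        (hψ.contDiff.continuous.comp (Continuous.prodMk_left x)).continuousOn
    have hderiv : ∀ t ∈ Ioo a₁ b₁, HasDerivWithinAt (fun t => ⟪W x, ψ t x⟫) (D (t, x))
        (Ioi t) t := by
      intro t _
      have hu' : HasDerivAt (fun _ : ℝ => W x) (0 : E) t := hasDerivAt_const t (W x)
      have hi := hu'.inner ℝ (hψ.hasDerivAt_time t x)
      simp only [inner_zero_left, add_zero] at hi
      exact hi.hasDerivWithinAt
    have hint : IntervalIntegrable (fun t => D (t, x)) volume a₁ b₁ := by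
      refine ContinuousOn.intervalIntegrable ?_
      rw [uIcc_of_le ha₁b₁.le]
      exact hDcont.comp (Continuous.prodMk_left x).continuousOn
        fun t ht => mk_mem_prod ht (mem_univ x)
    have := intervalIntegral.integral_eq_sub_of_hasDeriv_right_of_le ha₁b₁.le hcont hderiv hint
    rw [intervalIntegral.integral_of_le ha₁b₁.le, integral_Ioc_eq_integral_Ioo] at this
    rw [this, hψa₁ x, hψb₁ x, inner_zero_right, sub_self]
  rw [hstep, integral_congr_ae (Eventually.of_forall hline), integral_zero]

end Summit.NavierStokesRegularity.NavierStokesRegularity.Theorems.ScenarioCensus.SteadyRegularity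

/-! ### Regularity of bounded `C²` steady solutions on `ℝ³` -/

namespace Summit.NavierStokesRegularity.NavierStokesRegularity.Theorems.ScenarioCensus.SteadyRegularity

open Literature.Analysis Literature.Analysis.FluidPDE

/-- **Bounded `C²` steady solutions on `ℝ³` have smooth velocity.**  If `(W, Q)` is a `C²`/`C¹` steady solution of
the unforced Navier–Stokes system with viscosity `ν > 0` on `ℝ³` and `‖W‖ ≤ M`, then `W ∈ C^∞`.  Proof: at `ν = 1`
(`IsSteadyNSSolution.viscosity_one`) the time-independent field is a bounded weak ancient solution
(`isBoundedWeakNSSolutionOn_const`); KNSS 2009 §4 (`KNSS2009_regularity_boundedWeak_ancient_holds`, proved in the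
tree) gives `ν⁻¹ W = U(t) + b(t)` a.e. in `x` for a.e. `t < 0` with smooth slices `U(t)`; at one such time, two
continuous functions that agree a.e. agree, so `W` is a smooth function plus a constant.
[cite: KochNadirashviliSereginSverak2009, §4 (4.7) (arXiv:0709.3599 p. 8)] -/
theorem contDiff_velocity_of_bounded {ν : ℝ} (hν : 0 < ν)
    {W : EuclideanSpace ℝ (Fin 3) → EuclideanSpace ℝ (Fin 3)} {Q : EuclideanSpace ℝ (Fin 3) → ℝ}
    (h : IsSteadyNSSolution ν 0 W Q) {M : ℝ} (hM : ∀ x, ‖W x‖ ≤ M) :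
    ContDiff ℝ (⊤ : ℕ∞) W := by
  -- normalise the viscosity
  have h1 : IsSteadyNSSolution 1 0 (ν⁻¹ • W) (ν⁻¹ ^ 2 • Q) := by
    simpa only [smul_zero] using h.viscosity_one hν.ne'
  have hν0 : 0 ≤ ν⁻¹ := inv_nonneg.2 hν.le
  have hM1 : ∀ x, ‖(ν⁻¹ • W) x‖ ≤ ν⁻¹ * M := fun x => by
    rw [Pi.smul_apply, norm_smul, Real.norm_of_nonneg hν0]
    exact mul_le_mul_of_nonneg_left (hM x) hν0
  -- the time-independent field is a bounded weak ancient solution; KNSS §4 regularity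
  have hweak : IsBoundedWeakNSSolutionOn (Iio 0) isOpen_Iio 1 (fun _ : ℝ => ν⁻¹ • W) :=
    isBoundedWeakNSSolutionOn_const h1 hM1
  obtain ⟨U, b, -, -, -, hae, hsmooth, -⟩ := KNSS2009_regularity_boundedWeak_ancient_holds hweak
  -- a good time
  have hne : ∃ t : ℝ, t < 0 ∧ ((ν⁻¹ • W) =ᵐ[volume] fun x => U t x + b t) := by
    have h' : ∀ᵐ t ∂((volume : Measure ℝ).restrict (Iio 0)),
        t ∈ Iio (0 : ℝ) ∧ ((ν⁻¹ • W) =ᵐ[volume] fun x => U t x + b t) :=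
      (ae_restrict_mem measurableSet_Iio).and hae
    have hvol : (volume : Measure ℝ).restrict (Iio 0) ≠ 0 := by
      intro h0
      have := congrArg (fun μ : Measure ℝ => μ (Iio 0)) h0
      simp only [Measure.restrict_apply_self, Measure.coe_zero, Pi.zero_apply,
        Real.volume_Iio] at this
      exact ENNReal.top_ne_zero this
    haveI : (ae ((volume : Measure ℝ).restrict (Iio 0))).NeBot := ae_neBot.2 hvol
    obtain ⟨t, ht, hW⟩ := h'.exists
    exact ⟨t, ht, hW⟩
  obtain ⟨t₀, ht₀, hWt⟩ := hne
  -- two continuous functions agreeing a.e. agree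
  have hWc : Continuous (ν⁻¹ • W) := (h.contDiff_velocity.continuous).const_smul ν⁻¹
  have hUc : Continuous fun x => U t₀ x + b t₀ := (hsmooth t₀ ht₀).continuous.add continuous_const
  have heq : (ν⁻¹ • W) = fun x => U t₀ x + b t₀ := (Continuous.ae_eq_iff_eq volume hWc hUc).1 hWt
  have hsm : ContDiff ℝ (⊤ : ℕ∞) (ν⁻¹ • W) := by
    rw [heq]
    exact (hsmooth t₀ ht₀).add contDiff_const
  have hback : W = ν • (ν⁻¹ • W) := by
    rw [smul_smul, mul_inv_cancel₀ hν.ne', one_smul]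
  rw [hback]
  exact hsm.const_smul ν

/-- **… and smooth pressure**: `∇Q = νΔW − (W·∇)W` is smooth once `W` is, so `Q ∈ C^∞`
(`contDiff_infty_iff_fderiv`; `DQ = toDual ∘ ∇Q`). -/
theorem contDiff_pressure_of_bounded {ν : ℝ} (hν : 0 < ν)
    {W : EuclideanSpace ℝ (Fin 3) → EuclideanSpace ℝ (Fin 3)} {Q : EuclideanSpace ℝ (Fin 3) → ℝ}
    (h : IsSteadyNSSolution ν 0 W Q) {M : ℝ} (hM : ∀ x, ‖W x‖ ≤ M) :
    ContDiff ℝ (⊤ : ℕ∞) Q := by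
  have hW : ContDiff ℝ (⊤ : ℕ∞) W := contDiff_velocity_of_bounded hν h hM
  have hQd : Differentiable ℝ Q := h.contDiff_pressure.differentiable one_ne_zero
  -- `∇Q = νΔW − (W·∇)W`, a smooth field
  have hgrad : ∀ y, gradient Q y = ν • (Δ W) y - convect W W y := fun y => by
    have e := h.momentum y
    simp only [Pi.zero_apply] at e
    rw [eq_neg_of_add_eq_zero_right e]
    abel
  set G : EuclideanSpace ℝ (Fin 3) → EuclideanSpace ℝ (Fin 3) := fun y => ν • (Δ W) y - convect W W y with hG
  have hGs : ContDiff ℝ (⊤ : ℕ∞) G := by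
    have hΔ : ContDiff ℝ (⊤ : ℕ∞) (Δ W) := contDiff_laplacian_of_contDiff_infty hW
    have hconv : ContDiff ℝ (⊤ : ℕ∞) (convect W W) := by
      have hD : ContDiff ℝ (⊤ : ℕ∞) (fderiv ℝ W) := hW.fderiv_right (m := ∞) (by exact_mod_cast le_rfl)
      have : convect W W = fun y => fderiv ℝ W y (W y) := funext fun y => convect_apply W W y
      rw [this]
      exact hD.clm_apply hW
    exact (hΔ.const_smul ν).sub hconv
  -- `DQ = toDual ∘ ∇Q` is smooth, hence so is `Q`
  have hfd : fderiv ℝ Q = fun y => (InnerProductSpace.toDual ℝ (EuclideanSpace ℝ (Fin 3))) (G y) := by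
    funext y
    have hGy : G y = gradient Q y := by rw [hgrad y]
    rw [hGy, gradient, LinearIsometryEquiv.apply_symm_apply]
  have hfds : ContDiff ℝ (⊤ : ℕ∞) (fderiv ℝ Q) := by
    rw [hfd]
    exact (InnerProductSpace.toDual ℝ (EuclideanSpace ℝ (Fin 3))).contDiff.comp hGs
  exact contDiff_infty_iff_fderiv.2 ⟨hQd, hfds⟩

/-- **The census form.**  A Leray profile at rate `0` with viscosity `ν > 0` (`IsLerayProfile ν 0 U P`: a `C²`/`C¹`
steady Navier–Stokes solution on `ℝ³`) which tends to `0` at infinity — hence is bounded — is smooth together with its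
pressure.  This is the regularity hypothesis of `ScenarioCensus.row_S2_of_row_S2s_of_regularity`. -/
theorem contDiff_of_isLerayProfile_zero_of_tendsto {ν : ℝ} (hν : 0 < ν)
    {U : EuclideanSpace ℝ (Fin 3) → EuclideanSpace ℝ (Fin 3)} {P : EuclideanSpace ℝ (Fin 3) → ℝ}
    (hprof : IsLerayProfile ν 0 U P) (h0 : Tendsto U (cocompact (EuclideanSpace ℝ (Fin 3))) (𝓝 0)) :
    ContDiff ℝ (⊤ : ℕ∞) U ∧ ContDiff ℝ (⊤ : ℕ∞) P := by
  have hst : IsSteadyNSSolution ν 0 U P :=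
    { contDiff_velocity := hprof.contDiff_velocity
      contDiff_pressure := hprof.contDiff_pressure
      momentum := fun y => by
        have := hprof.profile_eq y
        simpa only [zero_smul, add_zero, Pi.zero_apply] using this
      divFree := hprof.divFree }
  -- bounded: continuous and tending to `0` at infinity
  obtain ⟨M, hM⟩ : ∃ M : ℝ, ∀ x, ‖U x‖ ≤ M := by
    have hUc : Continuous U := hprof.contDiff_velocity.continuous
    have hev : ∀ᶠ x in cocompact (EuclideanSpace ℝ (Fin 3)), ‖U x‖ < 1 := by
      have h1 : Tendsto (fun x => ‖U x‖) (cocompact (EuclideanSpace ℝ (Fin 3)))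
          (𝓝 ‖(0 : EuclideanSpace ℝ (Fin 3))‖) :=
        (continuous_norm.tendsto (0 : EuclideanSpace ℝ (Fin 3))).comp h0
      rw [norm_zero] at h1
      exact h1.eventually (gt_mem_nhds one_pos)
    obtain ⟨K, hK, hKc⟩ := mem_cocompact.1 hev
    obtain ⟨C, hC⟩ := hK.exists_bound_of_continuousOn hUc.continuousOn
    refine ⟨max C 1, fun x => ?_⟩
    by_cases hx : x ∈ K
    · exact (hC x hx).trans (le_max_left _ _)
    · have hx' : ‖U x‖ < 1 := hKc hx
      exact hx'.le.trans (le_max_right _ _)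
  exact ⟨contDiff_velocity_of_bounded hν hst hM, contDiff_pressure_of_bounded hν hst hM⟩

end Summit.NavierStokesRegularity.NavierStokesRegularity.Theorems.ScenarioCensus.SteadyRegularity

end
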